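import Summits.BirchSwinnertonDyer.BirchSwinnertonDyer.Theses.KatoDescentPotSupersingular
import Summits.BirchSwinnertonDyer.BirchSwinnertonDyer.Theorems.KatoDescentPotSupersingularWildLowerShaWitness
import Literature.NumberTheory.EllipticCurves.IsogenyIdProofs
import HarnessLib

/-!
# Route `KatoDescentPotSupersingular` (rung K9, cell `bsd-potss`): the DEPTH-UNIFORM certificate road to
# the crux `WildLowerHalfRankZero` (L₀, item stmt-BirchSwinnertonDyer-19195) — a certified divisibility
# `3^k ∣ #Ш` at one member, the Cassels–Tate rounding, the second-descent shape of the DEEP certificate,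
# and the COMPLETENESS of the road (a `--supports … --as helper` file; seat bsd-potss-k9-c2, generation 3)

Generation 2 (`…WildLowerShaWitness.lean`, p421575) typed the per-pair certificate of L₀ on the SHALLOW
intrinsic wild classes (a member with `ord₃ #Ш_an ≤ 2`: ONE nonzero `3`-torsion element of `Ш` + the
Cassels–Tate square) and displayed the DEEP classes (census: the 11 classes `N < 5·10⁵` with
`#Ш_an = 81` at the minimal member — 98280o1, 105408k1, 280962ce1, 328320de1, 386019q1, 402624cj1,
413559be1, 422253b1, 440775g1, 446904j1, 496584bv1 — where a first `3`-descent certifies only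
`dim Ш[3] = 2`, kit j250472, `dim Sel³ = 2` modulo GRH on all eleven, so the predicted shape is
`Ш[3^∞] ≅ (ℤ/9)²`) as a residual hypothesis. This file removes the depth distinction and shows that the
resulting road is exactly as strong as the crux:

* §1 (arithmetic of `#Ш` + Cassels–Tate): a certified divisibility `p^k ∣ #Ш` gives `k ≤ ord_p #Ш`;
  since `#Ш` is a perfect square when finite (`isSquare_card_sha_of_finite_of_casselsTate`, the PROVED
  corollary of the named fact `exists_casselsTate_pairing`), `ord_p #Ш` is EVEN, so in fact
  `k + (k mod 2) ≤ ord_p #Ш`; a subgroup `H ≤ Ш` with `p^k ∣ #H` certifies the divisibility (Lagrange);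
* §2 the DEEP certificate in the shape a second `p`-descent delivers it: an element `x ∈ Ш` of order
  `p²` and a `p`-torsion element `y ∉ ℤx` give `p³ ∣ #Ш` (`#Ш = #ℤx · [Ш : ℤx]` and the class of `y`
  in `Ш/ℤx` is a nonzero `p`-torsion element), hence `4 ≤ ord_p #Ш` by the rounding — what the 11 deep
  classes (`ord₃ #Ш_an = 4`) need;
* §3 hence `MissingLowerBoundAt W p` at every pair of analytic rank `≤ 1` (GZK: `Ш` finite) carrying a
  level-`k` divisibility certificate with `ord_p #Ш_an ≤ k + (k mod 2)` (`k = 1`: generation 2's shallow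
  road; `k = 3`: the deep road), and, by Cassels' transport of the lower half along the class
  (`TwistComparison.missingLowerBoundAt_of_isIsogenous`), at EVERY member of a wild class ONE of whose
  members carries such a certificate;
* §4 the crux BY NAME from the four published inputs and ONE CERTIFICATE PER CLASS, with NO residual row
  displayed (unit classes: `k = 0`; shallow: `k = 1` or `2`; deep: `k = 3`, …);
* §5 COMPLETENESS: conversely the crux hands back a certificate on every row (`k = ord₃ #Ш(W)` at the
  row itself), so over Cassels–Tate + Cassels + GZK + modularity the crux is EQUIVALENT to "every wild
  rank-0 row has, at some globally minimal member `W'` of its class, `3^k ∣ #Ш(W')` with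
  `ord₃ #Ш_an(W') ≤ k + (k mod 2)`" (`wildLowerHalfRankZero_iff_dvdWitnesses`): the per-class
  certificate ledger attached to the item (K9-intrinsic-classes-ledger.tsv: 1 759 / 1 770 intrinsic
  classes `N < 5·10⁵` CERTIFIED at `k ≤ 2`, the 11 deep ones OPEN at `k = 3`) is a ledger of instances
  of EXACTLY the crux's content, nothing weaker and nothing stronger.

HONEST LABEL: a certificate (`3^k ∣ #Ш(E)` from explicit elements of `Ш`) is an OBJECT the tree cannot
construct today (locally trivial torsors without rational points, exhibited by an explicit `p`-descent /
second descent outside the kernel); the hypotheses `hwit` below are per-class certificate SLOTS, every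
theorem here is conditional, and the item is NOT closed. Class-wide, "every wild rank-0 class has a
certificate" IS the crux (§5) — Kato's Conj. 12.10 at `3` on the non-CM intrinsic rows (generation 0,
kernel iff on the (12.5.2) rows `wildLowerHalf_towerSurj_iff_kmcThree`), an open problem. Nothing is
booked; BSD is not proved by any of this. Seat `bsd-potss-k9-c2` (prover-bsd-potss-k9-c2-g3-0),
generation 3.

References: [SilvermanAEC2009] Thm. X.4.14 (Cassels–Tate: a finite `Ш` has square order);
[Cassels1962ArithmeticIV]; [MilneADT2006] Thm. I.7.3 (isogeny invariance); [Miller2011LMS] Def. 1.1;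
[Kato2004Asterisque] Conj. 12.10 (p. 224); [SchaeferStoll2004] (explicit `p`-descent, the `k ≤ 2`
certificate engine); B. Creutz, "Second p-descents on elliptic curves", Math. Comp. 83 (2014) 365–409
(the engine that would fill the deep `k = 3` slots; not in the tree, not run).
-/

set_option autoImplicit false
-- sibling precedent (`KatoDescentPotSupersingularAssembly.lean`): the directory name repeats the summit name
set_option linter.dupNamespace false

noncomputable section

open scoped Classical

namespace Summit.BirchSwinnertonDyer.BirchSwinnertonDyer.Theorems

open WeierstrassCurve Literature.NumberTheory.EllipticCurves
  Literature.NumberTheory.EllipticCurves.Rank1Residual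
  Literature.NumberTheory.EllipticCurves.Rank1Residual.Typed
  Summit.BirchSwinnertonDyer.Rank1Residual.Additive
  Summit.BirchSwinnertonDyer.Rank1Residual
  Summit.BirchSwinnertonDyer.BirchSwinnertonDyer.Theses.KatoDescentPotSupersingular

/-! ## §1 A certified divisibility `p^k ∣ #Ш`: `k ≤ ord_p #Ш`, the Cassels–Tate rounding to an even
number, and the subgroup (Lagrange) feed -/

section Divisibility

variable (W : WeierstrassCurve ℚ) [W.IsElliptic] (p : ℕ) [hp : Fact p.Prime]

omit [W.IsElliptic] in
/-- **`k ≤ ord_p #Ш` from `p^k ∣ #Ш`** (finite `Ш`, so `#Ш ≠ 0`). [folklore] -/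
theorem le_padicValNat_shaOrder_of_pow_dvd [Finite W.sha] {k : ℕ} (hk : p ^ k ∣ W.shaOrder) :
    k ≤ padicValNat p W.shaOrder := by
  have hne : W.shaOrder ≠ 0 := by
    rw [WeierstrassCurve.shaOrder]; exact (Nat.card_pos (α := W.sha)).ne'
  exact (padicValNat_dvd_iff_le hne).mp hk

/-- **Cassels–Tate makes `ord_p #Ш` even** (finite `Ш`): `#Ш = m·m` by the tree's PROVED corollary
`isSquare_card_sha_of_finite_of_casselsTate` of the named fact `exists_casselsTate_pairing`, and
`ord_p (m·m) = 2·ord_p m`. A `private` local copy (instance-argument form) of the public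
`Theorems.even_padicValNat_shaOrder_of_casselsTate` of `ByReductionTypeAtTwoMultUpperHalfParity.lean`
(route `ByReductionTypeAtTwo`), kept private so that this K9 file does not import the 2-adic route's
cone. Conditional on `hCT`. [cite: SilvermanAEC2009, Thm. X.4.14] -/
private theorem even_padicValNat_shaOrder_of_casselsTate_local
    (hCT : exists_casselsTate_pairing (K := ℚ)) [Finite W.sha] : Even (padicValNat p W.shaOrder) := by
  obtain ⟨m, hm⟩ := isSquare_card_sha_of_finite_of_casselsTate hCT W
  have hm0 : m ≠ 0 := by
    rintro rfl
    exact (Nat.card_pos (α := W.sha)).ne' (by simpa using hm)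
  rw [WeierstrassCurve.shaOrder, hm, padicValNat.mul hm0 hm0]
  exact ⟨_, rfl⟩

/-- **The Cassels–Tate rounding**: `p^k ∣ #Ш` gives `k + (k mod 2) ≤ ord_p #Ш` (finite `Ш`; `ord_p #Ш`
is even and `≥ k`). For `k = 1` this is generation 2's
`two_le_padicValNat_shaOrder_of_torsionWitness_of_casselsTate`; for `k = 3` it is the deep rows'
`4 ≤ ord_p #Ш`. Conditional on `hCT`. [cite: SilvermanAEC2009, Thm. X.4.14] -/
theorem le_padicValNat_shaOrder_of_pow_dvd_of_casselsTate (hCT : exists_casselsTate_pairing (K := ℚ))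
    [Finite W.sha] {k : ℕ} (hk : p ^ k ∣ W.shaOrder) : k + k % 2 ≤ padicValNat p W.shaOrder := by
  have hle := le_padicValNat_shaOrder_of_pow_dvd W p hk
  obtain ⟨v, hv⟩ := even_padicValNat_shaOrder_of_casselsTate_local W p hCT
  omega

omit [W.IsElliptic] hp in
/-- **Lagrange in `Ш`** (the feed of the slot by a first descent): a subgroup `H ≤ Ш(E/ℚ)` with
`p^k ∣ #H` — e.g. `k` independent elements of `Ш[p]` — gives `p^k ∣ #Ш = shaOrder`. Pure group theory
(no finiteness needed: `Nat.card` of an infinite group is `0`). [folklore] -/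
theorem pow_dvd_shaOrder_of_addSubgroup (H : AddSubgroup W.sha) {k : ℕ} (hH : p ^ k ∣ Nat.card H) :
    p ^ k ∣ W.shaOrder := by
  rw [WeierstrassCurve.shaOrder]
  exact hH.trans (AddSubgroup.card_addSubgroup_dvd_card H)

end Divisibility

/-! ## §2 The DEEP certificate in second-descent shape: an element of order `p²` and an independent
`p`-torsion element give `p³ ∣ #Ш`, hence `4 ≤ ord_p #Ш` by Cassels–Tate -/

section Deep

variable (W : WeierstrassCurve ℚ) [W.IsElliptic] (p : ℕ) [hp : Fact p.Prime]

omit [W.IsElliptic] in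
/-- **`p³ ∣ #Ш` from an element `x` of order `p²` and a `p`-torsion element `y ∉ ℤx`**:
`#Ш = #ℤx · [Ш : ℤx] = p² · #(Ш/ℤx)`, and the class of `y` in `Ш/ℤx` is nonzero and killed by `p`, so
`p ∣ #(Ш/ℤx)`. This is the shape in which a second `p`-descent delivers the deep certificate: a
`p²`-covering lifting one of the first-descent `p`-coverings (the element `x`, with `p•x` a first-descent
class) and an independent first-descent class `y`. Pure group theory (no finiteness needed). [folklore] -/
theorem cube_dvd_shaOrder_of_deepWitness {x y : W.sha} (hx : addOrderOf x = p ^ 2) (hpy : p • y = 0)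
    (hy : y ∉ AddSubgroup.zmultiples x) : p ^ 3 ∣ W.shaOrder := by
  set H : AddSubgroup W.sha := AddSubgroup.zmultiples x with hHdef
  have hHcard : Nat.card H = p ^ 2 := by rw [hHdef, Nat.card_zmultiples, hx]
  -- the class of `y` in `Ш/H` is a nonzero `p`-torsion element, so `p ∣ [Ш : H]`
  have hybar : (y : W.sha ⧸ H) ≠ 0 := fun h ↦ hy ((QuotientAddGroup.eq_zero_iff y).mp h)
  have hpybar : p • (y : W.sha ⧸ H) = 0 := by
    rw [← QuotientAddGroup.mk_nsmul, hpy, QuotientAddGroup.mk_zero]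
  have hord : addOrderOf (y : W.sha ⧸ H) = p :=
    (hp.out.eq_one_or_self_of_dvd _ (addOrderOf_dvd_of_nsmul_eq_zero hpybar)).resolve_left
      fun h1 ↦ hybar (AddMonoid.addOrderOf_eq_one_iff.mp h1)
  have hindex : p ∣ H.index := by
    rw [AddSubgroup.index_eq_card, ← hord]
    exact addOrderOf_dvd_natCard _
  rw [WeierstrassCurve.shaOrder, ← AddSubgroup.card_mul_index H, hHcard, pow_succ]
  exact Nat.mul_dvd_mul_left (p ^ 2) hindex

/-- **`4 ≤ ord_p #Ш` from the deep certificate and Cassels–Tate** (finite `Ш`): `p³ ∣ #Ш` (§2) and the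
rounding of §1. Conditional on `hCT`. [cite: SilvermanAEC2009, Thm. X.4.14] -/
theorem four_le_padicValNat_shaOrder_of_deepWitness_of_casselsTate
    (hCT : exists_casselsTate_pairing (K := ℚ)) [Finite W.sha] {x y : W.sha}
    (hx : addOrderOf x = p ^ 2) (hpy : p • y = 0) (hy : y ∉ AddSubgroup.zmultiples x) :
    4 ≤ padicValNat p W.shaOrder := by
  have h := le_padicValNat_shaOrder_of_pow_dvd_of_casselsTate W p hCT
    (cube_dvd_shaOrder_of_deepWitness W p hx hpy hy)
  omega

end Deep

/-! ## §3 The lower half at a pair from a divisibility certificate, and along the class -/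

section Pair

variable (W : WeierstrassCurve ℚ) [W.IsElliptic] (p : ℕ) [hp : Fact p.Prime]

/-- **L₀ at a pair from a level-`k` certificate and Cassels–Tate**: in analytic rank `≤ 1` (GZK `hGZK`:
`Ш` finite), if `#Ш_an(W) = q` with `ord_p q ≤ k + (k mod 2)` and `p^k ∣ #Ш(W)`, then
`MissingLowerBoundAt W p`. `k = 1` is generation 2's `missingLowerBoundAt_of_torsionWitness_of_le_two`
(one `p`-torsion element, `ord_p #Ш_an ≤ 2`); `k = 3` is the deep road (`ord_p #Ш_an ≤ 4`). Conditional
on `hCT`, `hGZK` and the certificate slot. [cite: SilvermanAEC2009, Thm. X.4.14] [cite: Miller2011LMS, Def. 1.1] -/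
theorem missingLowerBoundAt_of_pow_dvd_of_casselsTate (hCT : exists_casselsTate_pairing (K := ℚ))
    (hGZK : rank_eq_analyticRank_of_analyticRank_le_one) (hr : W.analyticRank ≤ 1) {q : ℚ}
    (hq : shaAn W = (q : ℂ)) {k : ℕ} (hv : padicValRat p q ≤ ((k + k % 2 : ℕ) : ℤ))
    (hk : p ^ k ∣ W.shaOrder) : MissingLowerBoundAt W p := by
  haveI : Finite W.sha := (hGZK W hr).2
  have hle := le_padicValNat_shaOrder_of_pow_dvd_of_casselsTate W p hCT hk
  exact ⟨q, hq, hv.trans (by exact_mod_cast hle)⟩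

/-- **L₀ at a DEEP pair (`ord_p #Ш_an ≤ 4`) from the second-descent certificate and Cassels–Tate**: an
element of `Ш(W)` of order `p²` and a `p`-torsion element outside its multiples. The typed slot of the 11
deep census classes (`#Ш_an = 81`; `Ш[3] = (ℤ/3)²` by first descent, predicted `Ш[3^∞] ≅ (ℤ/9)²`).
Conditional on `hCT`, `hGZK` and the certificate slot. [cite: SilvermanAEC2009, Thm. X.4.14] [cite: Miller2011LMS, Def. 1.1] -/
theorem missingLowerBoundAt_of_deepWitness_of_le_four (hCT : exists_casselsTate_pairing (K := ℚ))
    (hGZK : rank_eq_analyticRank_of_analyticRank_le_one) (hr : W.analyticRank ≤ 1) {q : ℚ}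
    (hq : shaAn W = (q : ℂ)) (hv : padicValRat p q ≤ 4) {x y : W.sha} (hx : addOrderOf x = p ^ 2)
    (hpy : p • y = 0) (hy : y ∉ AddSubgroup.zmultiples x) : MissingLowerBoundAt W p :=
  missingLowerBoundAt_of_pow_dvd_of_casselsTate W p hCT hGZK hr hq (k := 3) (by simpa using hv)
    (cube_dvd_shaOrder_of_deepWitness W p hx hpy hy)

end Pair

/-- **L₀ at EVERY member of a wild class one of whose members carries a certificate.** For `W` globally
minimal of analytic rank `0` in `ClassO6 W 3`: if SOME globally minimal `W' ∼_ℚ W` has `#Ш_an(W') = q'`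
with `ord₃ q' ≤ k + (k mod 2)` and `3^k ∣ #Ш(W')`, then `MissingLowerBoundAt W 3` — §3 at `W'`, then
Cassels' transport of the lower half (the class defect `ord₃ #Ш − ord₃ #Ш_an` is an isogeny invariant
over Cassels `hCassels` + GZK + modularity, `TwistComparison.missingLowerBoundAt_of_isIsogenous`). The
depth-uniform form of generation 2's `missingLowerBoundAt_wild_of_isIsogenous_shallowWitness`.
Conditional on the four published facts and the certificate slot.
[cite: MilneADT2006, Thm. I.7.3] [cite: SilvermanAEC2009, Thm. X.4.14] [cite: Miller2011LMS, Def. 1.1] -/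
theorem missingLowerBoundAt_wild_of_isIsogenous_pow_dvd
    (hCT : exists_casselsTate_pairing (K := ℚ)) (hCassels : bsdRHS_eq_of_isIsogenous)
    (hGZK : rank_eq_analyticRank_of_analyticRank_le_one) (hmod : hasEntireLFunction_rat)
    (W : WeierstrassCurve ℚ) [W.IsElliptic] [W.IsGloballyMinimal] [Fact (3 : ℕ).Prime]
    (hr : W.analyticRank = 0) (_hO : ClassO6 W 3)
    (W' : WeierstrassCurve ℚ) [W'.IsElliptic] [W'.IsGloballyMinimal] (hiso : IsIsogenous W W')
    {q' : ℚ} (hq' : shaAn W' = (q' : ℂ)) {k : ℕ} (hv' : padicValRat 3 q' ≤ ((k + k % 2 : ℕ) : ℤ))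
    (hk : 3 ^ k ∣ W'.shaOrder) : MissingLowerBoundAt W 3 := by
  have hr' : W'.analyticRank ≤ 1 := by
    rw [← analyticRank_eq_of_isIsogenous' hiso, hr]; exact zero_le_one
  exact TwistComparison.missingLowerBoundAt_of_isIsogenous W' W 3 hCassels hGZK hmod
    hiso.symm_of_charZero hr' (missingLowerBoundAt_of_pow_dvd_of_casselsTate W' 3 hCT hGZK hr' hq' hv' hk)

/-- **The deep instance along the class**: L₀ at every member of a wild rank-`0` class SOME globally
minimal member `W'` of which has `ord₃ #Ш_an(W') ≤ 4` and carries the second-descent certificate (an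
element of `Ш(W')` of order `9` and a `3`-torsion element outside its multiples) — the slot of the 11
deep census classes. Conditional on the four published facts and the certificate slot.
[cite: MilneADT2006, Thm. I.7.3] [cite: SilvermanAEC2009, Thm. X.4.14] [cite: Miller2011LMS, Def. 1.1] -/
theorem missingLowerBoundAt_wild_of_isIsogenous_deepWitness
    (hCT : exists_casselsTate_pairing (K := ℚ)) (hCassels : bsdRHS_eq_of_isIsogenous)
    (hGZK : rank_eq_analyticRank_of_analyticRank_le_one) (hmod : hasEntireLFunction_rat)
    (W : WeierstrassCurve ℚ) [W.IsElliptic] [W.IsGloballyMinimal] [Fact (3 : ℕ).Prime]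
    (hr : W.analyticRank = 0) (hO : ClassO6 W 3)
    (W' : WeierstrassCurve ℚ) [W'.IsElliptic] [W'.IsGloballyMinimal] (hiso : IsIsogenous W W')
    {q' : ℚ} (hq' : shaAn W' = (q' : ℂ)) (hv' : padicValRat 3 q' ≤ 4) {x y : W'.sha}
    (hx : addOrderOf x = 3 ^ 2) (h3y : 3 • y = 0) (hy : y ∉ AddSubgroup.zmultiples x) :
    MissingLowerBoundAt W 3 :=
  missingLowerBoundAt_wild_of_isIsogenous_pow_dvd hCT hCassels hGZK hmod W hr hO W' hiso hq' (k := 3)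
    (by simpa using hv') (cube_dvd_shaOrder_of_deepWitness W' 3 hx h3y hy)

/-! ## §4 The crux BY NAME from one certificate per class (no residual row) -/

/-- **`WildLowerHalfRankZero` from the published inputs and ONE CERTIFICATE PER CLASS.** Inputs:
Cassels–Tate `hCT`, Cassels `hCassels`, GZK `hGZK`, modularity `hmod` (published); `hwit`: on every wild
rank-`0` row, SOME globally minimal member `W'` of its class with `#Ш_an(W') = q'`, a level `k` with
`ord₃ q' ≤ k + (k mod 2)`, and `3^k ∣ #Ш(W')` (the per-class certificate slot: unit classes `k = 0`; the
1 759 shallow intrinsic census classes `k ≤ 2`, a first `3`-descent, §1; the 11 deep ones `k = 3`, a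
second descent, §2). No row is displayed as residual. HONEST LABEL: a per-pair road made uniform by
hypothesis; class-wide `hwit` IS the crux (§5). Conditional; the item is NOT closed.
[cite: SilvermanAEC2009, Thm. X.4.14] [cite: MilneADT2006, Thm. I.7.3] [cite: Miller2011LMS, Def. 1.1]
[cite: Kato2004Asterisque, Conj. 12.10 (p. 224)] -/
theorem wildLowerHalfRankZero_of_dvdWitnesses
    (hCT : exists_casselsTate_pairing (K := ℚ)) (hCassels : bsdRHS_eq_of_isIsogenous)
    (hGZK : rank_eq_analyticRank_of_analyticRank_le_one) (hmod : hasEntireLFunction_rat)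
    (hwit : ∀ (W : WeierstrassCurve ℚ) [W.IsElliptic] [W.IsGloballyMinimal] [Fact (3 : ℕ).Prime],
      W.analyticRank = 0 → ClassO6 W 3 →
      ∃ (W' : WeierstrassCurve ℚ) (_ : W'.IsElliptic) (_ : W'.IsGloballyMinimal),
        IsIsogenous W W' ∧ ∃ (q' : ℚ) (k : ℕ),
          shaAn W' = (q' : ℂ) ∧ padicValRat 3 q' ≤ ((k + k % 2 : ℕ) : ℤ) ∧ 3 ^ k ∣ W'.shaOrder) :
    Summit.BirchSwinnertonDyer.BirchSwinnertonDyer.Theses.KatoDescentPotSupersingular.WildLowerHalfRankZero := by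
  intro W _ _ _ hr hO
  obtain ⟨W', hW', hM', hiso, q', k, hq', hv', hk⟩ := hwit W hr hO
  haveI := hW'
  haveI := hM'
  exact missingLowerBoundAt_wild_of_isIsogenous_pow_dvd hCT hCassels hGZK hmod W hr hO W' hiso hq' hv' hk

/-- **Generation 2's composition with its DEEP residual filled by a certificate slot.** The crux BY NAME
from the published inputs, generation 2's SHALLOW witness slot verbatim (`hwit`: one nonzero `3`-torsion
element of `Ш` at a member with `ord₃ #Ш_an ≤ 2` of every intrinsic class that has such a member) and, on
the DEEP rows (every globally minimal member has `ord₃ #Ш_an > 2`), a level-`k` certificate at some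
member (`hdeep`; census: `k = 3` by a second descent on the 11 deep classes) — i.e.
`wildLowerHalfRankZero_of_shallowWitnesses_of_deepRows` with its displayed residual `hdeep` DISCHARGED
from the certificate slot by `missingLowerBoundAt_wild_of_isIsogenous_pow_dvd`. Conditional; the item is
NOT closed. [cite: SilvermanAEC2009, Thm. X.4.14] [cite: MilneADT2006, Thm. I.7.3] [cite: Miller2011LMS, Def. 1.1] -/
theorem wildLowerHalfRankZero_of_shallowWitnesses_of_deepCertificates
    (hCT : exists_casselsTate_pairing (K := ℚ)) (hCassels : bsdRHS_eq_of_isIsogenous)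
    (hGZK : rank_eq_analyticRank_of_analyticRank_le_one) (hmod : hasEntireLFunction_rat)
    (hwit : ∀ (W : WeierstrassCurve ℚ) [W.IsElliptic] [W.IsGloballyMinimal] [Fact (3 : ℕ).Prime],
      W.analyticRank = 0 → ClassO6 W 3 →
      (∀ (W' : WeierstrassCurve ℚ) [W'.IsElliptic] [W'.IsGloballyMinimal], IsIsogenous W W' →
        ∀ q' : ℚ, shaAn W' = (q' : ℂ) → 0 < padicValRat 3 q') →
      (∃ (W' : WeierstrassCurve ℚ) (_ : W'.IsElliptic) (_ : W'.IsGloballyMinimal),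
        IsIsogenous W W' ∧ ∃ q' : ℚ, shaAn W' = (q' : ℂ) ∧ padicValRat 3 q' ≤ 2) →
      ∃ (W' : WeierstrassCurve ℚ) (_ : W'.IsElliptic) (_ : W'.IsGloballyMinimal),
        IsIsogenous W W' ∧ ∃ q' : ℚ, shaAn W' = (q' : ℂ) ∧ padicValRat 3 q' ≤ 2 ∧
          ∃ x : W'.sha, x ≠ 0 ∧ 3 • x = 0)
    (hdeep : ∀ (W : WeierstrassCurve ℚ) [W.IsElliptic] [W.IsGloballyMinimal] [Fact (3 : ℕ).Prime],
      W.analyticRank = 0 → ClassO6 W 3 →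
      (∀ (W' : WeierstrassCurve ℚ) [W'.IsElliptic] [W'.IsGloballyMinimal], IsIsogenous W W' →
        ∀ q' : ℚ, shaAn W' = (q' : ℂ) → 2 < padicValRat 3 q') →
      ∃ (W' : WeierstrassCurve ℚ) (_ : W'.IsElliptic) (_ : W'.IsGloballyMinimal),
        IsIsogenous W W' ∧ ∃ (q' : ℚ) (k : ℕ),
          shaAn W' = (q' : ℂ) ∧ padicValRat 3 q' ≤ ((k + k % 2 : ℕ) : ℤ) ∧ 3 ^ k ∣ W'.shaOrder) :
    Summit.BirchSwinnertonDyer.BirchSwinnertonDyer.Theses.KatoDescentPotSupersingular.WildLowerHalfRankZero :=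
  wildLowerHalfRankZero_of_shallowWitnesses_of_deepRows hCT hCassels hGZK hmod hwit
    fun W _ _ _ hr hO hdeepRow ↦ by
      obtain ⟨W', hW', hM', hiso, q', k, hq', hv', hk⟩ := hdeep W hr hO hdeepRow
      haveI := hW'
      haveI := hM'
      exact missingLowerBoundAt_wild_of_isIsogenous_pow_dvd hCT hCassels hGZK hmod W hr hO W' hiso hq'
        hv' hk

/-! ## §5 COMPLETENESS: the crux hands the certificates back, so the road loses nothing -/

/-- **The converse: `WildLowerHalfRankZero` gives a certificate on every wild rank-`0` row** — at the
row itself (`W' = W`) with `k = ord₃ #Ш(W)`: `3^k ∣ #Ш(W)` (`pow_padicValNat_dvd`) and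
`ord₃ #Ш_an ≤ k ≤ k + (k mod 2)`. Bookkeeping; no published input. [cite: Miller2011LMS, Def. 1.1] -/
theorem dvdWitnesses_of_wildLowerHalfRankZero
    (hL : Summit.BirchSwinnertonDyer.BirchSwinnertonDyer.Theses.KatoDescentPotSupersingular.WildLowerHalfRankZero) :
    ∀ (W : WeierstrassCurve ℚ) [W.IsElliptic] [W.IsGloballyMinimal] [Fact (3 : ℕ).Prime],
      W.analyticRank = 0 → ClassO6 W 3 →
      ∃ (W' : WeierstrassCurve ℚ) (_ : W'.IsElliptic) (_ : W'.IsGloballyMinimal),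
        IsIsogenous W W' ∧ ∃ (q' : ℚ) (k : ℕ),
          shaAn W' = (q' : ℂ) ∧ padicValRat 3 q' ≤ ((k + k % 2 : ℕ) : ℤ) ∧ 3 ^ k ∣ W'.shaOrder := by
  intro W _ _ _ hr hO
  obtain ⟨q, hq, hle⟩ := hL W hr hO
  refine ⟨W, inferInstance, inferInstance, isIsogenous_self W, q, padicValNat 3 W.shaOrder, hq, ?_,
    pow_padicValNat_dvd⟩
  refine hle.trans ?_
  exact_mod_cast Nat.le_add_right _ _

/-- **The certificate road is COMPLETE.** Over the published inputs (Cassels–Tate `hCT`, Cassels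
`hCassels`, GZK `hGZK`, modularity `hmod`) the crux `WildLowerHalfRankZero` is EQUIVALENT to "every wild
rank-`0` row has, at some globally minimal member `W'` of its class, `3^k ∣ #Ш(W')` for a `k` with
`ord₃ #Ш_an(W') ≤ k + (k mod 2)`". So the per-class certificate ledger attached to the item
(K9-intrinsic-classes-ledger.tsv: 1 759 / 1 770 intrinsic classes `N < 5·10⁵` certified at `k ≤ 2`, 11
open at `k = 3`; the 29 020 unit classes at `k = 0`) lists instances of EXACTLY the crux's content — and
the class-wide statement remains Kato's Conj. 12.10 at `3` on the non-CM intrinsic rows (generation 0's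
`wildLowerHalf_towerSurj_iff_kmcThree`), an open problem. Bookkeeping over published facts; nothing
credited. [cite: SilvermanAEC2009, Thm. X.4.14] [cite: MilneADT2006, Thm. I.7.3]
[cite: Miller2011LMS, Def. 1.1] [cite: Kato2004Asterisque, Conj. 12.10 (p. 224)] -/
theorem wildLowerHalfRankZero_iff_dvdWitnesses
    (hCT : exists_casselsTate_pairing (K := ℚ)) (hCassels : bsdRHS_eq_of_isIsogenous)
    (hGZK : rank_eq_analyticRank_of_analyticRank_le_one) (hmod : hasEntireLFunction_rat) :
    Summit.BirchSwinnertonDyer.BirchSwinnertonDyer.Theses.KatoDescentPotSupersingular.WildLowerHalfRankZero ↔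
    ∀ (W : WeierstrassCurve ℚ) [W.IsElliptic] [W.IsGloballyMinimal] [Fact (3 : ℕ).Prime],
      W.analyticRank = 0 → ClassO6 W 3 →
      ∃ (W' : WeierstrassCurve ℚ) (_ : W'.IsElliptic) (_ : W'.IsGloballyMinimal),
        IsIsogenous W W' ∧ ∃ (q' : ℚ) (k : ℕ),
          shaAn W' = (q' : ℂ) ∧ padicValRat 3 q' ≤ ((k + k % 2 : ℕ) : ℤ) ∧ 3 ^ k ∣ W'.shaOrder :=
  ⟨dvdWitnesses_of_wildLowerHalfRankZero,
    fun hwit ↦ wildLowerHalfRankZero_of_dvdWitnesses hCT hCassels hGZK hmod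
      (fun W _ _ _ hr hO ↦ hwit W hr hO)⟩

end Summit.BirchSwinnertonDyer.BirchSwinnertonDyer.Theorems

end
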